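import Mathlib
import Summits.KontsevichZagierPeriods.Zeta5Search.Certificates.RecordRayChain
import Summits.KontsevichZagierPeriods.Zeta5Search.Certificates.RecordRayDenominators
import Summits.KontsevichZagierPeriods.Zeta5Search.Certificates.RecordRayCone
import Summits.KontsevichZagierPeriods.Zeta5Search.Certificates.RecordRaySeedChain
import Summits.KontsevichZagierPeriods.Zeta5Search.Certificates.RecordRayIdentify
import Summits.KontsevichZagierPeriods.Zeta5Search.Certificates.RecordRayIdentPts00
import Summits.KontsevichZagierPeriods.Zeta5Search.Certificates.RecordRayIdentPts01
import Summits.KontsevichZagierPeriods.Zeta5Search.Certificates.RecordRayIdentPts02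
import Summits.KontsevichZagierPeriods.Zeta5Search.Certificates.RecordRayIdentPts03
import Summits.KontsevichZagierPeriods.Zeta5Search.Certificates.RecordRayIdentPts04
import Summits.KontsevichZagierPeriods.Zeta5Search.Certificates.RecordRayIdentPts05
import Summits.KontsevichZagierPeriods.Zeta5Search.Certificates.RecordRayIdentPts06
import Summits.KontsevichZagierPeriods.Zeta5Search.Certificates.RecordRayIdentPts07
import Summits.KontsevichZagierPeriods.Zeta5Search.Certificates.RecordRayIdentPts08
import Summits.KontsevichZagierPeriods.Zeta5Search.Certificates.RecordRayIdentPts09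
import Summits.KontsevichZagierPeriods.Zeta5Search.Certificates.RecordRayIdentPts10
import Summits.KontsevichZagierPeriods.Zeta5Search.Certificates.RecordRayIdentPts11
import HarnessLib

/-! # Record ray, (N) FOR EVERY `n ≥ 1` — W+H. the identification window and the assembly: `recordForm n ≠ 0` for all `n ≥ 1` (S4-R1 item #10)

Section `Window` (gen-2 g33's file `RecordRayIdentWindow`, merged here by P1 g15 to save one farm-build cycle): **N-2c discharged** —
`identWindow : ∀ j < 356, IdP j = true` assembled from the twelve kernel-checked chunks `RecordRayIdentPts00…11`, and
`identAt_of_mem_window`.  Section `Assembly`: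

`recordForm n = ρ_n · (W(b_n') F̃₇(b_n) − W(b_n) F̃₇(b_n')) ≠ 0` for every `n ≥ 1`, because `W(b_n) · W(b_n') < 0` (the `W`
column of the rational frame stays in the projective box `PBox n` along the whole record ray), `F̃₇(b_n) > 0`,
`F̃₇(b_n') ≥ 0` (tree: `vwpDual_record_pos`, `vwpDual_seven_pos`) and `ρ_n ≠ 0` (tree: `rhoOf_aRec_ne_zero`).
The box invariant `PBox_wCol` is an induction from `n = 1`: base = the seed chain (`RecordRaySeedChain.wCol_one_box`), step =
fam-tele's chain rule `T(b_{n+1}) = c • Pgen(n) • T(b_n)`, `c ≠ 0` (`RecordRayChain.frame_chain`, `cRec_ne`) + the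
identification `Pgen n = (c0 · Ĝ(n)) • P̂(n)` (`RecordRayIdentify.Pgen_eq_smul` with the window `RecordRayIdentWindow.identWindow`)
+ `Ĝ(n) > 0` (all roots `< 1`) + the cone step (`RecordRayCone.cone_step`).  Main theorem: `recordForm_ne_zero_all`.
The assembly lemmas keep K3 / the window / the base as explicit hypotheses (`PBox_wCol`, `recordForm_ne_zero_of`,
`recordForm_ne_zero_of'`, `recordForm_ne_zero_of_identWindow`) so that each input is visible by name.

Provenance: gen-2 g32's kernel-checked scratch `AllN_G15.lean` (2026-08-22, rc 0 / 0 sorry, axioms propext ·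
Classical.choice · Quot.sound), built on fam-tele g15's generic record-ray interface (`RecordRayGenericForms/Steps`,
`RecordRayMirror`, `RecordRayRaySteps`, `RecordRayChain`, all in the tree); data from gen-2 g31 (`P̂`, align) and fam-tele
g14 (`conn/PATH.md`).  Staged for the tree by gen-2 g33 (S4-R1 item #10).

HONEST FRAMING: systematic search; no irrationality claim unless certified; this is clause (N) of Brown–Zudilin's Theorem 1
(arXiv:2210.03391) for THEIR OWN record cell — the non-vanishing of their linear forms — and nothing about ζ(5) beyond that;
records UNMOVED. -/

namespace Summit.KontsevichZagierPeriods.Zeta5Search.RecordRay.Generic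

section Window

/-- **N-2c discharged — the identification window:** all 356 point identities `PgenM k = (c0 · Ĝ(k)) • P̂(k)`,
`k = −177 … 178` (index `j = k + 177 < 356`), assembled from the twelve chunks. -/
theorem identWindow : ∀ j : ℕ, j < 356 → IdP j = true := fun j hj =>
  (chunk_cat (chunk_cat (chunk_cat (chunk_cat (chunk_cat (chunk_cat (chunk_cat (chunk_cat (chunk_cat (chunk_cat (chunk_cat chunk_0 chunk_1) chunk_2) chunk_3) chunk_4) chunk_5) chunk_6) chunk_7) chunk_8) chunk_9) chunk_10) chunk_11) j (Nat.zero_le j) hj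

/-- The window at an integer point: `identAt k` for `−177 ≤ k ≤ 178`. -/
theorem identAt_of_mem_window {k : ℤ} (h1 : -177 ≤ k) (h2 : k ≤ 178) : identAt k = true := by
  obtain ⟨j, rfl⟩ : ∃ j : ℕ, k = (j : ℤ) - 177 := ⟨(k + 177).toNat, by omega⟩
  exact identWindow j (by omega)

end Window

section Assembly
open Matrix Finset
open Summit.KontsevichZagierPeriods.Zeta5Search.RecordRay.Connection (frameMat bRecord'_eq_bump)
open Summit.KontsevichZagierPeriods.Zeta5Search.WedgeDictionary (coeffW rhoOf bump)
open Summit.KontsevichZagierPeriods.Zeta5Search.DualSeriesLemma19 (bRecord)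
open Summit.KontsevichZagierPeriods.Zeta5Search.DualSeriesBounds (vwpDual_seven_pos)
open Summit.KontsevichZagierPeriods.Zeta5Search.RecordLine (bRecord'_eq)
open Literature.NumberTheory.Irrationality.BrownZudilin2022 (vwpDual)
open Summit.KontsevichZagierPeriods.Zeta5Search.RecordRay (recordForm)

/-- The `W` column of the rational frame on the record ray: `(W(b_n), W(b_n + e₇), W(b_n + 2e₇))`. -/
noncomputable def wCol (n : ℕ) : Fin 3 → ℚ := fun i => frameMat (bRecord n) i 1

/-- `wCol n 0 = W(b_n)`. -/
theorem wCol_zero_eq (n : ℕ) : wCol n 0 = coeffW (bRecord n) := by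
  simp [wCol, frameMat]

/-- `wCol n 1 = W(b_n')` (`b_n' = b_n + e₇`). -/
theorem wCol_one_eq (n : ℕ) : wCol n 1 = coeffW (bRecord' n) := by
  simp [wCol, frameMat, bRecord'_eq_bump]

/-- The chain rule on frames gives the chain rule on the `W` column: `wCol (n+1) = c • (Pgen n · wCol n)`. -/
theorem wCol_succ_of_chain {n : ℕ} {c : ℚ}
    (h : frameMat (bRecord (n + 1)) = c • (Pgen (n : ℚ) * frameMat (bRecord n))) :
    wCol (n + 1) = c • (Pgen (n : ℚ) *ᵥ wCol n) := by
  ext i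
  simp only [wCol, h, Matrix.smul_apply, Matrix.mul_apply, Pi.smul_apply, Matrix.mulVec, dotProduct]

/-- data fact: every root `m/d` of `Ĝ` has `d > 0` and `m < d`. -/
theorem ghatFac_roots : (ghatFac.all fun t => decide (0 < t.1) && decide (t.2.1 < t.1)) = true := by
  decide +kernel

/-- A product `∏ (d ν − m)^e` with all `0 < d`, `m < d` is positive at every rational `ν ≥ 1`. -/
theorem facFoldr_pos {L : List (ℤ × ℤ × ℕ)} (hL : (L.all fun t => decide (0 < t.1) && decide (t.2.1 < t.1)) = true)
    {ν : ℚ} (hν : 1 ≤ ν) :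
    0 < L.foldr (fun (t : ℤ × ℤ × ℕ) (acc : ℚ) => ((t.1 : ℚ) * ν - (t.2.1 : ℚ)) ^ t.2.2 * acc) 1 := by
  induction L with
  | nil => simp
  | cons t L ih =>
    simp only [List.all_cons, Bool.and_eq_true, decide_eq_true_eq] at hL
    obtain ⟨⟨hd, hm⟩, hL'⟩ := hL
    rw [List.foldr_cons]
    refine mul_pos (pow_pos ?_ _) (ih hL')
    have hd' : (0 : ℚ) < (t.1 : ℚ) := by exact_mod_cast hd
    have hm' : ((t.2.1 : ℤ) : ℚ) < (t.1 : ℚ) := by exact_mod_cast hm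
    nlinarith [mul_nonneg hd'.le (sub_nonneg.2 hν)]

/-- `Ĝ(ν) > 0` for every rational `ν ≥ 1` (all its roots lie below `1`). -/
theorem ghatG_pos {ν : ℚ} (hν : 1 ≤ ν) : 0 < ghatG ν := by
  unfold ghatG; exact facFoldr_pos ghatFac_roots hν

/-- **The cone invariant along the record ray**: `wCol n ∈ PBox n` for every `n ≥ 1` (K3 + N-2 + N-3 + N-4). -/
theorem PBox_wCol
    (chain : ∀ n : ℕ, 1 ≤ n → ∃ c : ℚ, c ≠ 0 ∧ frameMat (bRecord (n + 1)) = c • (Pgen (n : ℚ) * frameMat (bRecord n)))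
    (HId : ∀ j : ℕ, j < 356 → IdP j = true) (base : (∃ s r₁ r₂ : ℚ, s ≠ 0 ∧ 99 ≤ r₁ ∧ r₁ ≤ 100 ∧ 80 ≤ r₂ ∧ r₂ ≤ 100 ∧
      (wCol 1) 0 = s ∧ (wCol 1) 1 = -(s * r₁ * 1 ^ 2) ∧ (wCol 1) 2 = s * r₁ * r₂ * 1 ^ 4)) : ∀ n : ℕ, 1 ≤ n →
          (∃ s r₁ r₂ : ℚ, s ≠ 0 ∧ 99 ≤ r₁ ∧ r₁ ≤ 100 ∧ 80 ≤ r₂ ∧ r₂ ≤ 100 ∧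
      (wCol n) 0 = s ∧ (wCol n) 1 = -(s * r₁ * (n : ℚ) ^ 2) ∧ (wCol n) 2 = s * r₁ * r₂ * (n : ℚ) ^ 4) := by
  intro n hn
  induction n, hn using Nat.le_induction with
  | base => simpa using base
  | succ n hn ih =>
    obtain ⟨c, hc, hchain⟩ := chain n hn
    have hν : (1 : ℚ) ≤ (n : ℚ) := by exact_mod_cast hn
    have hc0 : (c0 : ℚ) ≠ 0 := by exact_mod_cast (show c0 ≠ 0 by decide)
    have hg : (c0 : ℚ) * ghatG (n : ℚ) ≠ 0 := mul_ne_zero hc0 (ghatG_pos hν).ne'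
    have e : wCol (n + 1) = (c * ((c0 : ℚ) * ghatG (n : ℚ))) • ((phatG (n : ℚ)).toMatrix *ᵥ wCol n) := by
      rw [wCol_succ_of_chain hchain, Pgen_eq_smul HId (n : ℚ), Matrix.smul_mulVec, smul_smul]
    rw [e]
    have step := pbox_smul (cone_step (ν := (n : ℚ)) (x := wCol n) hν ih) (mul_ne_zero hc hg)
    simpa using step

/-- **(N) for every `n ≥ 1`, assembled** (modulo K3, N-2c, N-4 as hypotheses):
`recordForm n = ρ_n · (W(b_n') F̃₇(b_n) − W(b_n) F̃₇(b_n')) ≠ 0`, because `W(b_n)·W(b_n') < 0` (cone), `F̃₇(b_n) > 0`,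
`F̃₇(b_n') ≥ 0`, `ρ_n ≠ 0`. -/
theorem recordForm_ne_zero_of
    (chain : ∀ n : ℕ, 1 ≤ n → ∃ c : ℚ, c ≠ 0 ∧ frameMat (bRecord (n + 1)) = c • (Pgen (n : ℚ) * frameMat (bRecord n)))
    (HId : ∀ j : ℕ, j < 356 → IdP j = true) (base : (∃ s r₁ r₂ : ℚ, s ≠ 0 ∧ 99 ≤ r₁ ∧ r₁ ≤ 100 ∧ 80 ≤ r₂ ∧ r₂ ≤ 100 ∧
      (wCol 1) 0 = s ∧ (wCol 1) 1 = -(s * r₁ * 1 ^ 2) ∧ (wCol 1) 2 = s * r₁ * r₂ * 1 ^ 4)) {n : ℕ}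
          (hn : 1 ≤ n) : recordForm n ≠ 0 := by
  have hν : (1 : ℚ) ≤ (n : ℚ) := by exact_mod_cast hn
  obtain ⟨-, hsgn⟩ := pbox_sign hν (PBox_wCol chain HId base n hn)
  rw [wCol_zero_eq, wCol_one_eq] at hsgn
  have hF : 0 < vwpDual 7 (bRecord n) := vwpDual_record_pos n
  have hF' : 0 ≤ vwpDual 7 (bRecord' n) := by
    rw [bRecord'_eq]; exact (vwpDual_seven_pos (hle_rec' hn) (hs_rec' n)).le
  have hρ : (rhoOf (aRec n) : ℝ) ≠ 0 := by exact_mod_cast rhoOf_aRec_ne_zero n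
  have hsgnR : (coeffW (bRecord n) : ℝ) * (coeffW (bRecord' n) : ℝ) < 0 := by exact_mod_cast hsgn
  unfold recordForm
  refine mul_ne_zero hρ fun hD => ?_
  have h1 : (coeffW (bRecord n) : ℝ) * (coeffW (bRecord' n) : ℝ) * vwpDual 7 (bRecord n) < 0 :=
    mul_neg_of_neg_of_pos hsgnR hF
  have h2 : 0 ≤ (coeffW (bRecord n) : ℝ) ^ 2 * vwpDual 7 (bRecord' n) := mul_nonneg (sq_nonneg _) hF'
  have h3 : (coeffW (bRecord n) : ℝ) * (coeffW (bRecord' n) : ℝ) * vwpDual 7 (bRecord n) =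
      (coeffW (bRecord n) : ℝ) ^ 2 * vwpDual 7 (bRecord' n) := by
    linear_combination ((coeffW (bRecord n) : ℚ) : ℝ) * hD
  linarith

/-- **N-4:** the base box at `b_1` holds — `RecordRaySeedChain.wCol_one_box` (the seed chain). -/
theorem base_PBox : (∃ s r₁ r₂ : ℚ, s ≠ 0 ∧ 99 ≤ r₁ ∧ r₁ ≤ 100 ∧ 80 ≤ r₂ ∧ r₂ ≤ 100 ∧
      (wCol 1) 0 = s ∧ (wCol 1) 1 = -(s * r₁ * 1 ^ 2) ∧ (wCol 1) 2 = s * r₁ * r₂ * 1 ^ 4) := by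
  obtain ⟨s, r₁, r₂, hs, h1, h2, h3, h4, e0, e1, e2⟩ := wCol_one_box
  refine ⟨s, r₁, r₂, hs, h1, h2, h3, h4, e0, ?_, ?_⟩
  · show frameMat (bRecord 1) 1 1 = _
    rw [e1]; ring
  · show frameMat (bRecord 1) 2 1 = _
    rw [e2]; ring

/-- **(N) for every `n ≥ 1`, modulo two named inputs:** the chain rule (K3) and the 356-point identification window
(N-2c), both as hypotheses. -/
theorem recordForm_ne_zero_of'
    (chain : ∀ n : ℕ, 1 ≤ n → ∃ c : ℚ, c ≠ 0 ∧ frameMat (bRecord (n + 1)) = c • (Pgen (n : ℚ) * frameMat (bRecord n)))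
    (HId : ∀ j : ℕ, j < 356 → IdP j = true) {n : ℕ} (hn : 1 ≤ n) : recordForm n ≠ 0 :=
  recordForm_ne_zero_of chain HId base_PBox hn

/-- **(N) for every `n ≥ 1`, modulo ONLY the identification window** — K3 instantiated with fam-tele g15's chain rule
`RecordRayChain.frame_chain` / `cRec_ne` (in the tree). -/
theorem recordForm_ne_zero_of_identWindow (HId : ∀ j : ℕ, j < 356 → IdP j = true) {n : ℕ}
    (hn : 1 ≤ n) : recordForm n ≠ 0 :=
  recordForm_ne_zero_of' (fun m hm => ⟨cRec m, cRec_ne hm, frame_chain hm⟩) HId hn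

/-! ### (N) for every `n ≥ 1` -/

/-- **(N) for EVERY `n ≥ 1`: the Brown–Zudilin record-cell linear form `recordForm n` does not vanish.**  No hypotheses:
K3 = fam-tele's chain rule (`RecordRayChain`), N-2 = degree bound + 356 kernel point identities + Lagrange
(`RecordRayPgenDegree`, `RecordRayIdentWindow`, `RecordRayIdentify`), N-3 = the cone step (`RecordRayCone`), N-4 = the seed
chain (`RecordRaySeedChain`).  This is clause (N) of arXiv:2210.03391 Theorem 1 for the authors' own cell, for all `n ≥ 1`;
it says nothing further about ζ(5). -/
theorem recordForm_ne_zero_all {n : ℕ} (hn : 1 ≤ n) : recordForm n ≠ 0 :=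
  recordForm_ne_zero_of_identWindow identWindow hn

end Assembly

end Summit.KontsevichZagierPeriods.Zeta5Search.RecordRay.Generic
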